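import Summits.AtomisticToContinuum.Crystallization.Theorems.FrustratedLawDichotomyStrainedPatchKernelCutA

/-!
# Strained patch — «KernelCut», part B: §4 the records (route-(F) / (F₆′) consumers with the kernel cut) and §5 the balance toy
(lens-5 g86 NODE «KernelCut» 561f554305dd44e1, 435 l; cut at the 400-line cap by hand-2 g39 for landing: A = §0–§3 (l.1–327), B = §4–§5 (l.329–435); bodies byte-verbatim,
opens l.74–117 repeated; full module docstring in part A.) -/

open scoped BigOperators Classical
open Literature.Analysis.ValidatedNumerics.Numerics (SC)
open Summit.AtomisticToContinuum.Crystallization.Theorems.ChargedEnergyGapNegative (eStar E3)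
open Summit.AtomisticToContinuum.Crystallization.Theorems.FrustratedLawDichotomyRangeCut
open Summit.AtomisticToContinuum.Crystallization.Theorems.FrustratedLawDichotomySchurCut
open Summit.AtomisticToContinuum.Crystallization.Theorems.FrustratedLawDichotomyMotifLemmas (GoodAtScale)
open Summit.AtomisticToContinuum.Crystallization.Theorems.FrustratedLawDichotomyAveragingCut (ballAvg)
open Summit.AtomisticToContinuum.Crystallization.Theorems.FrustratedLawDichotomyExemptLocOpt (LocOptFails)
open Summit.AtomisticToContinuum.Crystallization.Theorems.FrustratedLawDichotomyExemptSplit (SchurElasticPricingX)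
open Summit.AtomisticToContinuum.Crystallization.Theorems.FrustratedLawDichotomyExemptAbsorptionRecord
open Summit.AtomisticToContinuum.Crystallization.Theorems.FrustratedLawDichotomyCollarCensus
open Summit.AtomisticToContinuum.Crystallization.Theorems.FrustratedLawDichotomyCollarCensusKappa
open Summit.AtomisticToContinuum.Crystallization.Theorems.FrustratedLawDichotomyStrainedPatchHomSplit
open Summit.AtomisticToContinuum.Crystallization.Theorems.FrustratedLawDichotomyStrainedPatchCleanCollar (CleanBall TailPenalty AnnularDefectFloor
  DefectiveCollarFloor tailOut)
open Summit.AtomisticToContinuum.Crystallization.Theorems.FrustratedLawDichotomyStrainedPatchPhaseCut (MonoPhaseBall AnnularPhaseFloor PolyTextureFloor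
  monoPhaseBall_comp_iff FccGoodAtScale)
open Summit.AtomisticToContinuum.Crystallization.Theorems.FrustratedLawDichotomyStrainedPatchCoreTube (NearHomIsoAt CoreOffTubeFloor RimOffTubeFloor nearHomIsoAt_comp_iff)
open Summit.AtomisticToContinuum.Crystallization.Theorems.FrustratedLawDichotomyStrainedPatchCoreTubeRecord (CoreCoreRelief)
open Summit.AtomisticToContinuum.Crystallization.Theorems.FrustratedLawDichotomyStrainedPatchStrainBands (EdgeFarFloor coreOff_iff_edge_and_soft
  softFarFloor_eighth)
open Summit.AtomisticToContinuum.Crystallization.Theorems.FrustratedLawDichotomyStrainedPatchHomIsometry (admissible_comp_iff goodAtScale_comp_iff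
  dist_comp injective_comp_iff)
open Summit.AtomisticToContinuum.Crystallization.Theorems.FrustratedLawDichotomyStrainedPatchHomTubeIso (cleanBall_comp_iff ballAvg_xRec_comp)
open Summit.AtomisticToContinuum.Crystallization.Theorems.FrustratedLawDichotomyStrainedPatchChartFamilies (ChartBy FamilyLE familyLE_refl
  ChartBy.mono_t ChartBy.mono_family)
open Summit.AtomisticToContinuum.Crystallization.Theorems.FrustratedLawDichotomyStrainedPatchHostCells (TubeFloor FamilyCover FamP)
open Summit.AtomisticToContinuum.Crystallization.Theorems.FrustratedLawDichotomyStrainedPatchQuantSlaving (ChartFam SlackTab)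
open Summit.AtomisticToContinuum.Crystallization.Theorems.FrustratedLawDichotomyStrainedPatchGradedTube
open Summit.AtomisticToContinuum.Crystallization.Theorems.FrustratedLawDichotomyStrainedPatchCoverBridge
open Summit.AtomisticToContinuum.Crystallization.Theorems.FrustratedLawDichotomyStrainedPatchPairTube
open Summit.AtomisticToContinuum.Crystallization.Theorems.FrustratedLawDichotomyStrainedPatchHomCertTree (CertTree treeOK)
open Summit.AtomisticToContinuum.Crystallization.Theorems.FrustratedLawDichotomyStrainedPatchHomEntryGram (rootC rootW)
open Summit.AtomisticToContinuum.Crystallization.Theorems.FrustratedLawDichotomyStrainedPatchHomEntryGramHcp (rootCH rootWH)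
open Summit.AtomisticToContinuum.Crystallization.Theorems.FrustratedLawDichotomyStrainedPatchHomEntryLeafHT (entryLeafOK6RBKP4 semOKH)
open Summit.AtomisticToContinuum.Crystallization.Theorems.FrustratedLawDichotomyAperiodicGapRecordJunctionHomFloorF6p
open Summit.AtomisticToContinuum.Crystallization.Theorems.FrustratedLawDichotomyAperiodicGapRecordJunctionHomFloorGraded
open Summit.AtomisticToContinuum.Crystallization.Theorems.FrustratedLawDichotomyStrainedPatchQuantSlaving (HessTab ForceTab InForcePolytope linForce IsReach
  ForceCapLaw ForceCapOne siteForce norm_lin_le_of_cap_of_rem inForcePolytope_mono hessBlk0 force0)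
open Summit.AtomisticToContinuum.Crystallization.Theorems.FrustratedLawDichotomyStrainedPatchEnvelopeLaw (dev)
open Summit.AtomisticToContinuum.Crystallization.Theorems.FrustratedLawDichotomyAveragingCut (ball)
open Summit.AtomisticToContinuum.Crystallization.Theorems.FrustratedLawDichotomyStrainedPatchForceCap (forceCapOne forceCapLaw_of_le)
open Summit.AtomisticToContinuum.Crystallization.Theorems.FrustratedLawDichotomyAperiodicGapRecordJunctionHomFloorF6pT26
open Summit.AtomisticToContinuum.Crystallization.Theorems.FrustratedLawDichotomyStrainedPatchSoftSplit

namespace Summit.AtomisticToContinuum.Crystallization.Theorems.FrustratedLawDichotomyStrainedPatchKernelCut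

/-! ## §4. Records -/

section Record

variable {𝓘₀ 𝓘 : ChartFam} {𝓑 : BalPred} {𝓥 : ModeFam} {ρ ε τ₁ τ₂ τ₃ κ σ RI : ℝ} {T₁ : SlackTab} {H : HessTab} {F : ForceTab} {X : SlackTab}
  {βf sf βr sr β₁ β₂ s₁ s₂ : (M₀ : ℕ) → (Fin M₀ → E3) → Fin M₀ → ℝ}

/-- ★★★ (D_GB⋆ by host at ρ, ε) from the kernel cut at the RECORD table. [folklore instantiation] -/
theorem refineGBRecByAt_of_kernelCut (hR : BalancedRefit 𝓘₀ 𝓘 𝓑 ρ ε (1 / 8) (1 / 25) (constTol (1 / 25)) τ₁ T₁)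
    (hE : SlavingEnclosureG 𝓘 𝓑 ρ ε (1 / 8) τ₁ T₁ κ σ H F X)
    (hP : PairKernelCert 𝓘 𝓑 τ₁ T₁ κ σ H F X (1 / 25) (constTol (1 / 25)) (relConeBy 2 βf sf (1 / 25))) : RefineGBRecByAt 𝓘₀ 𝓘 ρ ε βf sf :=
  refineGB_of_kernelCut hR hE hP

/-- ★★★ Route (F), `ρ = 26/5`: [CORE-FAR] from the host-graded E-cell of record, the record cover (K⋆) and the kernel cut — through the tree's
`coreOff_26_5_of_pairTubeRecBy`. [folklore instantiation] -/
theorem coreOff_26_5_of_kernelCut (hT : TubeFloorGBRecBy 𝓘 βf sf) (hK : FamilyCoverGRecAt 𝓘₀ (26 / 5) (1 / 100))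
    (hR : BalancedRefit 𝓘₀ 𝓘 𝓑 (26 / 5) (1 / 100) (1 / 8) (1 / 25) (constTol (1 / 25)) τ₁ T₁)
    (hE : SlavingEnclosureG 𝓘 𝓑 (26 / 5) (1 / 100) (1 / 8) τ₁ T₁ κ σ H F X)
    (hP : PairKernelCert 𝓘 𝓑 τ₁ T₁ κ σ H F X (1 / 25) (constTol (1 / 25)) (relConeBy 2 βf sf (1 / 25))) :
    CoreOffTubeFloor (63 / 10) (63 / 10) (26 / 5) (1 / 100) 0 :=
  coreOff_26_5_of_pairTubeRecBy hT hK (refineGBRecByAt_of_kernelCut hR hE hP)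

/-- ★★★ THE SOFT RECORD: (R) ∧ (E) ∧ (P over `𝓥` at `(τ₁', β₁, s₁)`) ∧ (S) ∧ [sums dominated] ⟹ (D_GB⋆ by host at ρ, ε) — the kernel cut composed with g85's
`refineGBRecByAt_of_softSplit` (the LP of (P) runs on the STIFF quotient; the soft amplitude is (S)'s). [folklore instantiation] -/
theorem refineGBRecByAt_of_kernelCutS (hR : BalancedRefit 𝓘₀ 𝓘 𝓑 ρ ε (1 / 8) (1 / 25) (constTol (1 / 25)) τ₁ T₁)
    (hE : SlavingEnclosureG 𝓘 𝓑 ρ ε (1 / 8) τ₁ T₁ κ σ H F X)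
    (hP : PairKernelCertS 𝓘 𝓑 𝓥 τ₁ T₁ κ σ H F X τ₂ (constTol τ₂) (relConeBy 2 β₁ s₁ τ₂))
    (hS : SoftEnvelope 𝓥 τ₃ (constTol τ₃) (relConeBy 2 β₂ s₂ τ₃)) (hτ : τ₂ + τ₃ ≤ 1 / 25)
    (hβ : ∀ (M₀ : ℕ) (z₀ : Fin M₀ → E3) (c₀ : Fin M₀), β₁ M₀ z₀ c₀ + β₂ M₀ z₀ c₀ ≤ βf M₀ z₀ c₀)
    (hs : ∀ (M₀ : ℕ) (z₀ : Fin M₀ → E3) (c₀ : Fin M₀), s₁ M₀ z₀ c₀ + s₂ M₀ z₀ c₀ ≤ sf M₀ z₀ c₀) : RefineGBRecByAt 𝓘₀ 𝓘 ρ ε βf sf :=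
  refineGBRecByAt_of_softSplit (refineGBS_of_kernelCut hR hE hP) hS hτ hβ hs

/-- ★★★ THE RIM-LOOSE RECORD: [CORE-FAR] at any `(ρ, ε)` from an E-cell RE-CERTIFIED at the radius-graded table «RIMLOOSE-86», the cover (K⋆ at ρ, ε) and the
kernel cut with (P₀) at the radius-graded table (which survives BEND-86 by construction) — through the tree's `coreOff_of_tubeFloorGB_of_coarse_of_refineGB`.
[folklore instantiation] -/
theorem coreOff_of_kernelCut_rimCone (hT : TubeFloorGB 𝓘 (1 / 25) (constTol (1 / 25)) (rimConeBy RI βf sf βr sr (1 / 25)))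
    (hK : FamilyCoverGRecAt 𝓘₀ ρ ε) (hR : BalancedRefit 𝓘₀ 𝓘 𝓑 ρ ε (1 / 8) (1 / 25) (constTol (1 / 25)) τ₁ T₁)
    (hE : SlavingEnclosureG 𝓘 𝓑 ρ ε (1 / 8) τ₁ T₁ κ σ H F X)
    (hP : PairKernelCert 𝓘 𝓑 τ₁ T₁ κ σ H F X (1 / 25) (constTol (1 / 25)) (rimConeBy RI βf sf βr sr (1 / 25))) :
    CoreOffTubeFloor (63 / 10) (63 / 10) ρ ε 0 :=
  coreOff_of_tubeFloorGB_of_coarse_of_refineGB hT hK (refineGB_of_kernelCut hR hE hP)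

/-- ★ … and a certificate at the record table is a certificate at every dominating radius-graded table (so the rim-loose record asks LESS of (P)).
[formal bookkeeping] -/
theorem pairKernelCert_rimCone_of_relCone {τ : ℝ} {T : SlackTab}
    (hβ : ∀ (M₀ : ℕ) (z₀ : Fin M₀ → E3) (c₀ : Fin M₀), βf M₀ z₀ c₀ ≤ βr M₀ z₀ c₀)
    (hs : ∀ (M₀ : ℕ) (z₀ : Fin M₀ → E3) (c₀ : Fin M₀), sf M₀ z₀ c₀ ≤ sr M₀ z₀ c₀)
    (h : PairKernelCert 𝓘 𝓑 τ₁ T₁ κ σ H F X τ T (relConeBy 2 βf sf (1 / 25))) :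
    PairKernelCert 𝓘 𝓑 τ₁ T₁ κ σ H F X τ T (rimConeBy RI βf sf βr sr (1 / 25)) :=
  fun M z c M₀ z₀ c₀ e hch hb hP => (h M z c M₀ z₀ c₀ e hch hb hP).mono_pair (pairLE_relConeBy_rimConeBy hβ hs)

/-- ★★★ **THE CRUX BY NAME on route (F₆′) at the (α)-switch literals (T26/μ₇₄)** through the landed consumer of record
`aperiodicFrustratedLawGap_of_entryTree6RBKP4_semOKH_fallbackLever_pairTube_A35000_T26_record` (p854049) with its T-leaf `hDf : RefineGBRecByAt 𝓘₀ 𝓘 (26/5) (1/100) βf sf`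
REPLACED by the kernel cut (R) ∧ (E) ∧ (P₀) (the same `hDf` also feeds the RIM inside the consumer).  [folklore instantiation] -/
theorem aperiodicFrustratedLawGap_of_entryTree6RBKP4_semOKH_fallbackLever_kernelCut_A35000_T26_record {εE CE DE DX : ℝ}
    (hε0 : 0 < εE) (hε1 : εE ≤ 1 / 10000) (hDX : 0 ≤ DX)
    (hEl : SchurElasticPricingX (1 / 20) (1 / 8) w₄₅ ω₄ (3 / 400) (-(7175 / 10000)) (1 / 10000) CE DE DX (LocOptFails eStar εE (3 / 2) 1))
    (hFcc : ∃ t : CertTree (Fin 3 × Fin 3), treeOK (entryLeafOK6RBKP4 (-399210329969189)) t rootC rootW = true)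
    (hHcp : semOKH (-399210329969189) rootCH rootWH = true)
    (hT : ∀ (M : ℕ) (z : Fin M → E3) (c : Fin M), Admissible M z c → CleanBall (63 / 10) z c → MonoPhaseBall (63 / 10) z c →
      NearHomIsoAt (26 / 5) (1 / 100) z c → -(13 / 50000) ≤ ballAvg (9 / 5) z (tailOut (26 / 5) M z c) c)
    (hRl : CoreCoreRelief (63 / 10) (63 / 10) (26 / 5) (1 / 100) (3 / 5000))
    (hTB : TubeFloorGBRecBy 𝓘 βf sf) (hK : FamilyCoverGRecAt 𝓘₀ (26 / 5) (1 / 100))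
    (hRf : BalancedRefit 𝓘₀ 𝓘 𝓑 (26 / 5) (1 / 100) (1 / 8) (1 / 25) (constTol (1 / 25)) τ₁ T₁)
    (hEn : SlavingEnclosureG 𝓘 𝓑 (26 / 5) (1 / 100) (1 / 8) τ₁ T₁ κ σ H F X)
    (hPk : PairKernelCert 𝓘 𝓑 τ₁ T₁ κ σ H F X (1 / 25) (constTol (1 / 25)) (relConeBy 2 βf sf (1 / 25)))
    (hF : AnnularPhaseFloor (63 / 10) (24 / 5) (63 / 10) (1 / 1000)) (hP : PolyTextureFloor (63 / 10) (24 / 5) (1 / 1000))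
    (hA : AnnularDefectFloor (24 / 5) (63 / 10)) (hD : DefectiveCollarFloor (24 / 5))
    (h2 : CrowdedCoreMotifPricingCapK (1 / 1000) (9 / 5) (133 / 10) (3 / 2) (effPot w₄₅ ω₄ (3 / 400)) (-(7175 / 10000) + 3 / 400)
      (Collar (9 / 2) fun N y j => (∃ s : ℝ, 0 ≤ s ∧ s ≤ 3 / 2 ∧ NonEquilibriumCore (-(7175 / 10000)) 0 7 s (1 / 10000) N y j) ∨
        GoodAtScale (1 / 20) (3 / 2) y j))
    (h3 : DiluteDefectMotifPricingCapK (1 / 1000) (9 / 5) (133 / 10) (3 / 2) (effPot w₄₅ ω₄ (3 / 400)) (-(7175 / 10000) + 3 / 400)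
      (Collar (9 / 2) fun N y j => (∃ s : ℝ, 0 ≤ s ∧ s ≤ 3 / 2 ∧ NonEquilibriumCore (-(7175 / 10000)) 0 7 s (1 / 10000) N y j) ∨
        GoodAtScale (1 / 20) (3 / 2) y j)) :
    Summit.AtomisticToContinuum.Crystallization.Theses.FrustratedLawDichotomy.AperiodicFrustratedLawGap :=
  aperiodicFrustratedLawGap_of_entryTree6RBKP4_semOKH_fallbackLever_pairTube_A35000_T26_record hε0 hε1 hDX hEl hFcc hHcp hT hRl hTB hK
    (refineGBRecByAt_of_kernelCut hRf hEn hPk) hF hP hA hD h2 h3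

end Record

/-! ## §5. Toy: why the refit's BALANCE is load-bearing — rigid/affine modes are invisible to the linear force rows of a centrosymmetric stencil -/

section Toy

variable {ι : Type*} [Fintype ι]

/-- ★ On a CENTROSYMMETRIC stencil (`r (σ i) = −r i`, `Φ (σ i) = Φ i` for an index involution-free relabelling `σ : ι ≃ ι`) the linearised force row of every
LINEAR displacement field `u = L` vanishes: `Σ_i Φ_i (L r_i) = 0`.  Hence rotations and homogeneous strains (and, one Taylor order up, Cauchy–Born-equilibrated
quadratics and cubics) are constrained by the coarse box and the refit ONLY — the content of piece (R) and of the rim obstruction BEND-86.  (Exact on the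
fcc-type classes FZ09/FZ62; on hcp-centred hosts (HM62) strains stay partly visible through the inner-displacement coupling, rotations stay invisible on
every equilibrium host up to the residual `force0`.) [folklore] -/
theorem stencil_pair_sum_eq_zero (σ : ι ≃ ι) (r : ι → E3) (Φ : ι → (E3 →L[ℝ] E3)) (L : E3 →L[ℝ] E3) (hr : ∀ i, r (σ i) = -r i)
    (hΦ : ∀ i, Φ (σ i) = Φ i) : ∑ i, Φ i (L (r i)) = 0 := by
  have h : ∑ i, Φ i (L (r i)) = ∑ i, Φ (σ i) (L (r (σ i))) := (Equiv.sum_comp σ (fun i => Φ i (L (r i)))).symm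
  have h' : ∑ i, Φ (σ i) (L (r (σ i))) = -∑ i, Φ i (L (r i)) := by
    rw [← Finset.sum_neg_distrib]
    refine Finset.sum_congr rfl fun i _ => ?_
    rw [hr i, hΦ i, map_neg, map_neg]
  have h2 : (2 : ℝ) • ∑ i, Φ i (L (r i)) = 0 := by
    rw [two_smul]
    nth_rewrite 2 [h]
    rw [h', add_neg_cancel]
  exact (smul_eq_zero.1 h2).resolve_left two_ne_zero

end Toy

end Summit.AtomisticToContinuum.Crystallization.Theorems.FrustratedLawDichotomyStrainedPatchKernelCut
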